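import Summits.Ventures.HSemireg.Pad4TowerChiralityBlind

/-!
# Pad4Tower ∕ ChiralityBlindStatic (part 2 of 2) — the X and A2I families, the diamond ∕ cone ∕ line shapes, `G₁`-closure and odd FC are chirality-blind; `staticGame_chiralityBlind`

HONEST FRAMING. Sequel of `Pad4TowerChiralityBlind` (same folder note `hodge-bloch-bc5-plan/work/g10/lean/ChiralityBlind.lean` dfecbae03a48c221 of the
№3 bc5-witness planner `hodge-bloch-bc5-plan` g10, evidence-only lineage on stmt-HodgeConjecture-18881 `EightfoldBlochSeeds.BlochSeedDiscOne`; skeleton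
`Cruxes/BlochSeedDiscOne/Lines/birth.lean` 814a6a70c14e831a UNTOUCHED). Theorems ABOUT THE TYPED STATIC PREDICATES OF RECORD only; nothing here is an
object, a σ, a seed or a census row; NOTHING HERE SAYS THAT HC ∕ HC_CM ∕ HC_AV ∕ H2 ∕ 18881 ∕ (T_h) HOLDS OR FAILS; width toward H2 = 0. No `sorry`,
no `axiom`, no `instance`, no notation, no Literature fact.

WHAT (see part 1 for the dictionary `conjPt (α, Re β, Im β) = (α, Re β, −Im β)`, `crf k = 3k`, `MCell.conj`, `MConfig.conjImage` and RULE D). Here: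
`xMinusClosed_conjImage`, `xPlusClosed_conjImage` (§5), `a2iMinusClosed_conjImage`, `a2iPlusClosed_conjImage`, the `ι_h`-dual readings for every `h`
(`a2iMinusClosed_dual_conjImage` = the anomaly lens’s `AFlatStatic h`, `xMinusClosed_dual_conjImage`, `ruleDMu4Closed_dual_conjImage`) (§6),
`inDiamond_conjImage`, `inCone_conjImage`, inside a diamond `lineSupport_conjImage` (the negation lens’s `LineSupport h`, definiens verbatim) ∕
`ceilingAnchored_conjImage` ∕ `floorAnchored_conjImage` (§7), `g1Closed_conjImage`, `hasOddFC_conjImage` (`conj_pat`: the phase-bit pattern is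
conjugation-invariant) (§8), `staticH1_conjImage` and **`staticGame_chiralityBlind`** (§9) with the consequences for the seeds of record: a configuration
refutes `(T_h) = SeedB1OddDiamondG1H1 h`, `(T_∞) = SeedB1OddConeG1H1`, `(TL_h)`, `(SP_h)` or `SeedB1OddAFlat h` iff its mirror image does
(`seedB1OddCounterexample_conj_iff`, `seedB1OddConeCounterexample_conj_iff`, `seedB1OddLineCounterexample_conj_iff`, `seedB1OddSpanningCounterexample_conj_iff`,
`seedB1OddAFlatCounterexample_conj_iff`) — so machine searches, replays and kernel transcriptions of static supports may be run in either sign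
convention of `Im β` (director-hodge R19.26 (1): «for every TYPED predicate and every instance count the sign convention is IMMATERIAL»); §10 two
`decide` probes (the reflection is not in `G₁`; it moves the chiral letter `ℓ_i`).

SOURCES: as in part 1 (`Pad4TowerTorusBlindBase` ∕ `Pad4TowerTorusBlind` layout, gs-eng-2 g53; `Pad4TowerB1OddSpanControl`; `Pad4TowerB1OddBoostBlind`;
`Pad4TowerSeedB1Odd`; `Pad4TowerFCCoreSeam`; `Pad4TowerDiamondMu4`); director-hodge R19.18 l.34937, R19.21 l.34973, R19.26 l.34995. Typed ≠ proved for every (T_h). -/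

namespace Summit.Ventures.HSemireg.Pad4Tower

open Finset

namespace Chirality

/-! ## §5 The X family is chirality-blind -/

section XFamily

variable (C : MConfig)

/-- reflection covariance: `Sibling`. -/
theorem sibling_conj (q n : MCell) (σ w : Fin 4) : Sibling q.conj n.conj σ (crf w) ↔ Sibling q n σ w := by
  simp only [Sibling, magree_conj, conj_apply, conjPt_fst]
  constructor
  · rintro ⟨h1, h2, h3⟩
    refine ⟨h1, h2, conjPt_injective ?_⟩
    rw [h3, conjPt_ray]
  · rintro ⟨h1, h2, h3⟩
    refine ⟨h1, h2, ?_⟩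
    rw [h3, conjPt_ray, ← h3]

/-- reflection covariance: `NoCompanion`. -/
theorem noCompanion_conj (q n : MCell) (σ w : Fin 4) :
    NoCompanion C.conjImage q.conj n.conj σ (crf w) ↔ NoCompanion C q n σ w := by
  simp only [NoCompanion, forall_conjImage_upper, magree_conj, conj_apply, conjPt_fst, ne_eq, conjPt_eq_ray_iff]

/-- reflection covariance: `HeOkP`. -/
theorem heOkP_conj (Z q n : MCell) (σ : Fin 4) : HeOkP C.conjImage Z.conj q.conj n.conj σ ↔ HeOkP C Z q n σ := by
  simp only [HeOkP, forall_conjImage_upper, magree_conj, conj_apply, ne_eq, conjPt_injective.eq_iff, bsub_conjPt, effective_conjPt,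
    timelike_conjPt]

/-- reflection covariance: `HbOkP`. -/
theorem hbOkP_conj (Z n : MCell) (σ f : Fin 4) : HbOkP C.conjImage Z.conj n.conj σ f ↔ HbOkP C Z n σ f := by
  simp only [HbOkP, forall_conjImage_upper, magree2_conj, conj_apply, nullBelow_conjPt, bsub_conjPt, effective_conjPt, timelike_conjPt]

/-- reflection covariance: `WfEmpty`. -/
theorem wfEmpty_conj (Z : MCell) (f : Fin 4) : WfEmpty C.conjImage Z.conj f ↔ WfEmpty C Z f := by
  simp only [WfEmpty, forall_conjImage_upper, magree_conj, magree2_conj, conj_apply, nullBelow_conjPt]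

/-- one X instance, reflected (partner direction `u` and sibling direction `w` both mapped by `crf`). -/
theorem xresXFires_conj (Z q n : MCell) (σ u w f : Fin 4) :
    XresXFires C.conjImage Z.conj q.conj n.conj σ (crf u) (crf w) f ↔ XresXFires C Z q n σ u w f := by
  simp only [XresXFires, uPartner_conj, sibling_conj, noCompanion_conj, heOkP_conj, hbOkP_conj, wfEmpty_conj, forall_conjImage_upper,
    ne_eq, crf_injective.eq_iff, conj_apply, isApex_conjPt, conjPt_fst]

/-- **the X family (X⁻ reading) is chirality-blind.** -/
theorem xresXClosed_conjImage : XresXClosed C.conjImage ↔ XresXClosed C := by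
  simp only [XresXClosed, forall_conjImage_lower, forall_conjImage_upper]
  refine forall_congr' fun Z => forall_congr' fun _ => forall_congr' fun q => forall_congr' fun _ =>
    forall_congr' fun n => forall_congr' fun _ => forall_congr' fun σ => ?_
  rw [← forall_crf]
  refine forall_congr' fun u => ?_
  rw [← forall_crf]
  refine forall_congr' fun w => forall_congr' fun f => ?_
  rw [xresXFires_conj]

/-- **X⁻ is chirality-blind.** -/
theorem xMinusClosed_conjImage : XMinusClosed C.conjImage ↔ XMinusClosed C := xresXClosed_conjImage C

/-- the `ι_h`-dual of `Pad4TowerRuleDMu4Dual` (any `h`) commutes with the reflection, pointwise … -/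
theorem dualPt_conjPt (h : ℤ) (x : BPoint) : dualPt h (conjPt x) = conjPt (dualPt h x) := by
  obtain ⟨a, b, c⟩ := x; simp [dualPt, conjPt]

/-- … on cells … -/
theorem dualCell_conj (h : ℤ) (Z : MCell) : dualCell h Z.conj = (dualCell h Z).conj := by
  funext f; simp only [dualCell, conj_apply, dualPt_conjPt]

/-- … and on configurations. -/
theorem dual_conjImage (h : ℤ) : C.conjImage.dual h = (C.dual h).conjImage := by
  have e : dualCell h ∘ MCell.conj = MCell.conj ∘ dualCell h := funext fun X => dualCell_conj h X
  simp only [MConfig.dual, MConfig.conjImage, Finset.image_image, e]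

/-- **X⁺ (the dual reading) is chirality-blind.** -/
theorem xPlusClosed_conjImage : XPlusClosed C.conjImage ↔ XPlusClosed C := by
  rw [XPlusClosed, dual_conjImage, xresXClosed_conjImage]

end XFamily

/-! ## §6 The A2I family is chirality-blind -/

section A2IFamily

variable (C : MConfig)

/-- apex points are fixed by the reflection. -/
theorem conjPt_apex (a : ℤ) : conjPt (a, 0, 0) = (a, 0, 0) := by simp [conjPt]

/-- the encoder's own-ray direction follows the map. -/
theorem encDir_conjPt (x : BPoint) (u : Fin 4) : EncDir (conjPt x) (crf u) ↔ EncDir x u := by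
  have key : ∀ a c, (conjPt x = ray (a, 0, 0) (crf u) c) ↔ (x = ray (a, 0, 0) u c) := fun a c => by
    have := conjPt_eq_ray_iff (a, 0, 0) x u c
    rwa [conjPt_apex] at this
  simp only [EncDir, conjPt_fst, cabs_conjPt, key]

/-- «on the `u`-line at or below» follows the map. -/
theorem onULineBelowEq_conjPt (x y : BPoint) (u : Fin 4) : OnULineBelowEq (conjPt x) (conjPt y) (crf u) ↔ OnULineBelowEq x y u := by
  simp only [OnULineBelowEq, conjPt_fst, conjPt_eq_ray_iff]

/-- one A2I instance, reflected (own direction `u` and server direction `v` both mapped by `crf`). -/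
theorem xresA2IFires_conj (Z q N' : MCell) (σ u f' v : Fin 4) :
    XresA2IFires C.conjImage Z.conj q.conj N'.conj σ (crf u) f' (crf v) ↔ XresA2IFires C Z q N' σ u f' v := by
  simp only [XresA2IFires, uPartner_conj, forall_conjImage_upper, magree_conj, magree2_conj, conj_apply, isApex_conjPt, conjPt_fst,
    cabs_conjPt, encDir_conjPt, nullBelow_conjPt, bsub_conjPt, effective_conjPt, spacelike_conjPt, onULineBelowEq_conjPt, conjPt_eq_ray_iff,
    conjPt_injective.eq_iff, ne_eq]
  refine and_congr_right fun _ => and_congr_right fun _ => and_congr_right fun _ => and_congr_right fun _ =>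
    and_congr_right fun _ => and_congr_right fun _ => ?_
  refine and_congr ?_ Iff.rfl
  refine forall_congr' fun P => forall_congr' fun _ => ?_
  rw [← forall_crf]
  simp only [crf_injective.eq_iff, uPartner_conj]

/-- **the A2I family (A2I⁻ reading) is chirality-blind.** -/
theorem xresA2IClosed_conjImage : XresA2IClosed C.conjImage ↔ XresA2IClosed C := by
  simp only [XresA2IClosed, forall_conjImage_lower, forall_conjImage_upper]
  refine forall_congr' fun Z => forall_congr' fun _ => forall_congr' fun q => forall_congr' fun _ =>
    forall_congr' fun N' => forall_congr' fun _ => forall_congr' fun σ => ?_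
  rw [← forall_crf]
  refine forall_congr' fun u => forall_congr' fun f' => ?_
  rw [← forall_crf]
  refine forall_congr' fun v => ?_
  rw [xresA2IFires_conj]

/-- **A2I⁻ is chirality-blind.** -/
theorem a2iMinusClosed_conjImage : A2IMinusClosed C.conjImage ↔ A2IMinusClosed C := xresA2IClosed_conjImage C

/-- **A2I⁺ (the dual reading) is chirality-blind.** -/
theorem a2iPlusClosed_conjImage : A2IPlusClosed C.conjImage ↔ A2IPlusClosed C := by
  rw [A2IPlusClosed, dual_conjImage, xresA2IClosed_conjImage]

/-- **the `ι_h`-dual reading of A2I⁻ is chirality-blind** for every `h` — this is the anomaly lens's `AFlatStatic h C := A2IMinusClosed (C.dual h)`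
(`Cruxes/BlochSeedDiscOne/ThinnessTarget.lean`, not imported here), hence A♭_h-staticity and the binders of `ThinnessLaw h` ∕ `SeedB1OddAFlat h`. -/
theorem a2iMinusClosed_dual_conjImage (h : ℤ) : A2IMinusClosed (C.conjImage.dual h) ↔ A2IMinusClosed (C.dual h) := by
  rw [dual_conjImage, a2iMinusClosed_conjImage]

/-- the same for the `ι_h`-dual readings of X⁻ and of RULE D. -/
theorem xMinusClosed_dual_conjImage (h : ℤ) : XMinusClosed (C.conjImage.dual h) ↔ XMinusClosed (C.dual h) := by
  rw [dual_conjImage, xMinusClosed_conjImage]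

/-- the `ι_h`-dual reading of RULE D is chirality-blind (RULE D of the dual-`h` world of the mirror image ↔ of the dual-`h` world). -/
theorem ruleDMu4Closed_dual_conjImage (h : ℤ) : RuleDMu4Closed (C.conjImage.dual h) ↔ RuleDMu4Closed (C.dual h) := by
  rw [dual_conjImage, ruleDMu4Closed_conjImage]

end A2IFamily

/-! ## §7 The diamond and the cone are chirality-blind -/

/-- «β on an axis or zero» is reflection-invariant. -/
theorem axisOrZero_conjPt (x : BPoint) : ((conjPt x).2 = (0, 0) ∨ AxisPt (conjPt x)) ↔ (x.2 = (0, 0) ∨ AxisPt x) := by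
  obtain ⟨a, b, c⟩ := x
  simp [conjPt, AxisPt]

/-- the absolute charge of an axis letter is reflection-invariant (NOT of a general point: `chargeOf = Re β − Im β`). -/
theorem absCharge_conjPt {x : BPoint} (hx : x.2 = (0, 0) ∨ AxisPt x) : absCharge (conjPt x) = absCharge x := by
  obtain ⟨a, b, c⟩ := x
  simp only [AxisPt, Prod.mk.injEq] at hx
  rcases hx with ⟨rfl, rfl⟩ | ⟨-, rfl⟩ | ⟨rfl, -⟩ <;> simp [conjPt, absCharge, chargeOf, abs_neg]

/-- the diamond universe ◇_h is reflection-invariant, letter by letter … -/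
theorem inDiamond_conjPt (h : ℤ) (x : BPoint) : InDiamond h (conjPt x) ↔ InDiamond h x := by
  simp only [InDiamond]
  rw [axisOrZero_conjPt, conjPt_fst]
  constructor
  · rintro ⟨hax, h2, h3, h4⟩
    rw [absCharge_conjPt hax] at h2 h3 h4
    exact ⟨hax, h2, h3, h4⟩
  · rintro ⟨hax, h2, h3, h4⟩
    rw [← absCharge_conjPt hax] at h2 h3 h4
    exact ⟨hax, h2, h3, h4⟩

/-- … and configuration by configuration. -/
theorem inDiamond_conjImage (C : MConfig) (h : ℤ) : C.conjImage.InDiamond h ↔ C.InDiamond h := by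
  simp only [MConfig.InDiamond, forall_conjImage_lower, forall_conjImage_upper, MCell.InDiamond, conj_apply, inDiamond_conjPt]

/-- the height-free cone is reflection-invariant, letter by letter … -/
theorem inCone_conjPt (x : BPoint) : InCone (conjPt x) ↔ InCone x := by
  simp only [InCone]
  rw [axisOrZero_conjPt, conjPt_fst]
  constructor
  · rintro ⟨hax, h2, h3⟩
    rw [absCharge_conjPt hax] at h2 h3
    exact ⟨hax, h2, h3⟩
  · rintro ⟨hax, h2, h3⟩
    rw [← absCharge_conjPt hax] at h2 h3
    exact ⟨hax, h2, h3⟩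

/-- … and configuration by configuration. -/
theorem inCone_conjImage (C : MConfig) : C.conjImage.InCone ↔ C.InCone := by
  simp only [MConfig.InCone, forall_conjImage_lower, forall_conjImage_upper, conj_apply, inCone_conjPt]

/-- an axis letter stays on the ceiling line `α + c = h` … -/
theorem onCeiling_conjPt (h : ℤ) {x : BPoint} (hx : x.2 = (0, 0) ∨ AxisPt x) : OnCeiling h (conjPt x) ↔ OnCeiling h x := by
  simp only [OnCeiling, conjPt_fst, absCharge_conjPt hx]

/-- … and on the floor line `α = c`. -/
theorem onFloor_conjPt {x : BPoint} (hx : x.2 = (0, 0) ∨ AxisPt x) : OnFloor (conjPt x) ↔ OnFloor x := by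
  simp only [OnFloor, conjPt_fst, absCharge_conjPt hx]

/-- the letters of a reflected diamond cell stay on the ceiling line … -/
theorem onCeiling_conj {h' : ℤ} {Z : MCell} (hZ : MCell.InDiamond h' Z) (h : ℤ) (f : Fin 4) : OnCeiling h (Z.conj f) ↔ OnCeiling h (Z f) := by
  rw [conj_apply]; exact onCeiling_conjPt h (hZ f).1

/-- … and on the floor line. -/
theorem onFloor_conj {h' : ℤ} {Z : MCell} (hZ : MCell.InDiamond h' Z) (f : Fin 4) : OnFloor (Z.conj f) ↔ OnFloor (Z f) := by
  rw [conj_apply]; exact onFloor_conjPt (hZ f).1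

/-- **LINE SUPPORTS are chirality-blind** (inside some ◇_{h′}, where every letter is an axis letter): the shape of the negation lens's
`LineSupport h C` (`Cruxes/BlochSeedDiscOne/CeilingLineGame.lean`, not imported here; this is its definiens verbatim). -/
theorem lineSupport_conjImage {C : MConfig} {h' : ℤ} (hC : C.InDiamond h') (h : ℤ) :
    ((∀ Z ∈ C.conjImage.lower, ∀ f, OnCeiling h (Z f)) ∧ ∀ P ∈ C.conjImage.upper, ∀ f, OnCeiling h (P f)) ↔
      ((∀ Z ∈ C.lower, ∀ f, OnCeiling h (Z f)) ∧ ∀ P ∈ C.upper, ∀ f, OnCeiling h (P f)) := by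
  rw [forall_conjImage_lower, forall_conjImage_upper]
  exact and_congr (forall₂_congr fun Z hZ => forall_congr' fun f => onCeiling_conj (hC.1 Z hZ) h f)
    (forall₂_congr fun P hP => forall_congr' fun f => onCeiling_conj (hC.2 P hP) h f)

/-- ceiling-anchoring is chirality-blind (inside a diamond) … -/
theorem ceilingAnchored_conjImage {C : MConfig} {h' : ℤ} (hC : C.InDiamond h') (h : ℤ) :
    C.conjImage.CeilingAnchored h ↔ C.CeilingAnchored h := by
  rw [MConfig.CeilingAnchored, MConfig.CeilingAnchored, exists_conjImage_lower, exists_conjImage_upper]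
  exact or_congr (exists_congr fun Z => and_congr_right fun hZ => exists_congr fun f => onCeiling_conj (hC.1 Z hZ) h f)
    (exists_congr fun P => and_congr_right fun hP => exists_congr fun f => onCeiling_conj (hC.2 P hP) h f)

/-- … and so is floor-anchoring. -/
theorem floorAnchored_conjImage {C : MConfig} {h' : ℤ} (hC : C.InDiamond h') : C.conjImage.FloorAnchored ↔ C.FloorAnchored := by
  rw [MConfig.FloorAnchored, MConfig.FloorAnchored, exists_conjImage_lower, exists_conjImage_upper]
  exact or_congr (exists_congr fun Z => and_congr_right fun hZ => exists_congr fun f => onFloor_conj (hC.1 Z hZ) f)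
    (exists_congr fun P => and_congr_right fun hP => exists_congr fun f => onFloor_conj (hC.2 P hP) f)

/-! ## §8 `G₁`-closure and the odd-FC presence clause are chirality-blind -/

/-- the reflection commutes with the factor permutations. -/
theorem conj_perm (τ : Equiv.Perm (Fin 4)) (Z : MCell) : (Z.perm τ).conj = Z.conj.perm τ := rfl

/-- the reflection conjugates `Δ` to `Δ⁻¹ = Δ³`: reflecting then rotating is rotating back three times then reflecting. -/
theorem conj_delta (Z : MCell) : Z.conj.delta = Z.delta.delta.delta.conj := by
  funext f
  simp only [MCell.delta, conj_apply, deltaPt, conjPt, neg_neg]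

/-- a `Δ`-closed level is `Δ³`-closed. -/
theorem delta3_mem_of_deltaClosed {S : Finset MCell} (h : DeltaClosed S) {Z : MCell} (hZ : Z ∈ S) : Z.delta.delta.delta ∈ S :=
  h _ (h _ (h _ hZ))

/-- `Δ`-closure passes to the mirror image of a level … -/
theorem deltaClosed_conj_of {S : Finset MCell} (h : DeltaClosed S) : DeltaClosed (S.image MCell.conj) := by
  intro W hW
  obtain ⟨Z, hZ, rfl⟩ := Finset.mem_image.mp hW
  rw [conj_delta]
  exact Finset.mem_image_of_mem _ (delta3_mem_of_deltaClosed h hZ)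

/-- the mirror image of the mirror image of a level is the level. -/
theorem image_conj_image_conj (S : Finset MCell) : (S.image MCell.conj).image MCell.conj = S := by
  rw [Finset.image_image]
  have e : MCell.conj ∘ MCell.conj = id := funext conj_conj
  simp [e]

/-- … and back: `Δ`-closure is reflection-invariant. -/
theorem deltaClosed_conj_iff (S : Finset MCell) : DeltaClosed (S.image MCell.conj) ↔ DeltaClosed S :=
  ⟨fun h => by simpa only [image_conj_image_conj] using deltaClosed_conj_of h, deltaClosed_conj_of⟩

/-- `S₄`-closure is reflection-invariant. -/
theorem permClosed_conj_iff (S : Finset MCell) : PermClosed (S.image MCell.conj) ↔ PermClosed S :=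
  forall_congr' fun τ => closed_image_iff (op := fun Z => Z.perm τ) (b := MCell.conj) conj_injective (fun Z => (conj_perm τ Z).symm)

/-- **`G₁`-closure is chirality-blind** (although the reflection is not in `G₁`: it normalises it). -/
theorem g1Closed_conjImage (C : MConfig) : C.conjImage.G1Closed ↔ C.G1Closed := by
  simp only [MConfig.G1Closed, MConfig.conjImage, permClosed_conj_iff, deltaClosed_conj_iff]

/-- the phase bit of a letter (`Im β = 0` or not) is reflection-invariant … -/
theorem kbit_conjPt (x : BPoint) : kbit (conjPt x) = kbit x := by
  simp only [kbit, conjPt, neg_eq_zero]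

/-- … hence so is the parity pattern of a cell … -/
theorem conj_pat (Z : MCell) : Z.conj.pat = Z.pat := by
  simp only [MCell.pat, conj_apply, kbit_conjPt]

/-- a charged letter stays charged. -/
theorem conjPt_snd_ne (x : BPoint) : (conjPt x).2 ≠ (0, 0) ↔ x.2 ≠ (0, 0) := by
  obtain ⟨a, b, c⟩ := x; simp [conjPt]

/-- … and full charge. -/
theorem conj_fcc (Z : MCell) : FCc Z.conj ↔ FCc Z := forall_congr' fun f => conjPt_snd_ne (Z f)

/-- **the odd-FC presence clause is chirality-blind.** -/
theorem hasOddFC_conjImage (C : MConfig) : C.conjImage.HasOddFC ↔ C.HasOddFC := by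
  simp only [MConfig.HasOddFC, exists_conjImage_lower, exists_conjImage_upper, conj_fcc, conj_pat]

/-! ## §9 Chirality blindness assembled, and what it says for the seeds of record -/

/-- the `H₁` bundle is chirality-blind. -/
theorem staticH1_conjImage (C : MConfig) : C.conjImage.StaticH1 ↔ C.StaticH1 := by
  simp only [MConfig.StaticH1, ruleDMu4Closed_conjImage, xPlusClosed_conjImage, a2iMinusClosed_conjImage]

/-- **CHIRALITY BLINDNESS OF THE STATIC GAME (R19.18 (3) answered, h-uniform, census-free):** every static family of record, every diamond
universe, the cone, `G₁`-closure and the odd-FC presence clause are invariant under the mirror image `β ↦ β̄` of a two-level configuration. -/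
theorem staticGame_chiralityBlind (C : MConfig) :
    (RuleDMu4Closed C.conjImage ↔ RuleDMu4Closed C) ∧ (XMinusClosed C.conjImage ↔ XMinusClosed C) ∧
    (XPlusClosed C.conjImage ↔ XPlusClosed C) ∧ (A2IMinusClosed C.conjImage ↔ A2IMinusClosed C) ∧
    (A2IPlusClosed C.conjImage ↔ A2IPlusClosed C) ∧ (∀ h : ℤ, C.conjImage.InDiamond h ↔ C.InDiamond h) ∧
    (C.conjImage.InCone ↔ C.InCone) ∧ (C.conjImage.G1Closed ↔ C.G1Closed) ∧ (C.conjImage.HasOddFC ↔ C.HasOddFC) ∧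
    (C.conjImage.StaticH1 ↔ C.StaticH1) :=
  ⟨ruleDMu4Closed_conjImage C, xMinusClosed_conjImage C, xPlusClosed_conjImage C, a2iMinusClosed_conjImage C, a2iPlusClosed_conjImage C,
    inDiamond_conjImage C, inCone_conjImage C, g1Closed_conjImage C, hasOddFC_conjImage C, staticH1_conjImage C⟩

/-- **consequence for `(T_h)`:** a configuration is a counterexample to `SeedB1OddDiamondG1H1 h` (inside ◇_h, `G₁`-closed, `H₁`-static, with an
odd FC class) iff its mirror image is — searches, replays and kernel transcriptions may use either chirality convention. -/
theorem seedB1OddCounterexample_conj_iff (h : ℤ) (C : MConfig) :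
    (C.conjImage.InDiamond h ∧ C.conjImage.G1Closed ∧ C.conjImage.StaticH1 ∧ C.conjImage.HasOddFC) ↔
      (C.InDiamond h ∧ C.G1Closed ∧ C.StaticH1 ∧ C.HasOddFC) := by
  rw [inDiamond_conjImage, g1Closed_conjImage, staticH1_conjImage, hasOddFC_conjImage]

/-- the same for the height-free seed `(T_∞) = SeedB1OddConeG1H1`. -/
theorem seedB1OddConeCounterexample_conj_iff (C : MConfig) :
    (C.conjImage.InCone ∧ C.conjImage.G1Closed ∧ C.conjImage.StaticH1 ∧ C.conjImage.HasOddFC) ↔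
      (C.InCone ∧ C.G1Closed ∧ C.StaticH1 ∧ C.HasOddFC) := by
  rw [inCone_conjImage, g1Closed_conjImage, staticH1_conjImage, hasOddFC_conjImage]

/-- **the same for the LINE target `(TL_h) = SeedB1OddLine h`** of the negation lens (binders spelled out: `LineSupport h C` is the second
conjunct verbatim): an odd H₁-static `G₁`-closed LINE design of height `h` in one chirality convention is one in the other. -/
theorem seedB1OddLineCounterexample_conj_iff (h : ℤ) (C : MConfig) :
    (C.conjImage.InDiamond h ∧ ((∀ Z ∈ C.conjImage.lower, ∀ f, OnCeiling h (Z f)) ∧ ∀ P ∈ C.conjImage.upper, ∀ f, OnCeiling h (P f)) ∧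
        C.conjImage.G1Closed ∧ C.conjImage.StaticH1 ∧ C.conjImage.HasOddFC) ↔
      (C.InDiamond h ∧ ((∀ Z ∈ C.lower, ∀ f, OnCeiling h (Z f)) ∧ ∀ P ∈ C.upper, ∀ f, OnCeiling h (P f)) ∧
        C.G1Closed ∧ C.StaticH1 ∧ C.HasOddFC) := by
  rw [inDiamond_conjImage, g1Closed_conjImage, staticH1_conjImage, hasOddFC_conjImage]
  exact and_congr_right fun hC => and_congr_left' (lineSupport_conjImage hC h)

/-- **and for the spanning class `(SP_h)`** of the parity-direct residual (bc5-plan g10 v1 `ParityDirect.SeedB1OddSpanning`, binders spelled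
out): floor- and ceiling-anchored odd static designs come in mirror pairs too. -/
theorem seedB1OddSpanningCounterexample_conj_iff (h : ℤ) (C : MConfig) :
    (C.conjImage.InDiamond h ∧ C.conjImage.FloorAnchored ∧ C.conjImage.CeilingAnchored h ∧ C.conjImage.G1Closed ∧ C.conjImage.StaticH1 ∧
        C.conjImage.HasOddFC) ↔
      (C.InDiamond h ∧ C.FloorAnchored ∧ C.CeilingAnchored h ∧ C.G1Closed ∧ C.StaticH1 ∧ C.HasOddFC) := by
  rw [inDiamond_conjImage, g1Closed_conjImage, staticH1_conjImage, hasOddFC_conjImage]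
  exact and_congr_right fun hC => by rw [floorAnchored_conjImage hC, ceilingAnchored_conjImage hC]

/-- **the A♭-restricted seed `SeedB1OddAFlat h`** of the anomaly lens (binder `AFlatStatic h C = A2IMinusClosed (C.dual h)` spelled out). -/
theorem seedB1OddAFlatCounterexample_conj_iff (h : ℤ) (C : MConfig) :
    (C.conjImage.InDiamond h ∧ C.conjImage.G1Closed ∧ C.conjImage.StaticH1 ∧ A2IMinusClosed (C.conjImage.dual h) ∧ C.conjImage.HasOddFC) ↔
      (C.InDiamond h ∧ C.G1Closed ∧ C.StaticH1 ∧ A2IMinusClosed (C.dual h) ∧ C.HasOddFC) := by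
  rw [inDiamond_conjImage, g1Closed_conjImage, staticH1_conjImage, a2iMinusClosed_dual_conjImage, hasOddFC_conjImage]

/-! ## §10 Kernel probes (`decide`): the reflection is not in `G₁`, and it moves a chiral cell -/

/-- the chiral letter `ℓ_i = (1, 0, −1)` goes to `ℓ_{−i} = (1, 0, 1)`; `Δ` sends it to `(1, 1, 0) = ℓ₁` instead — the reflection is not `Δ`,
`Δ²` (which gives `(1, 0, 1)` too, but sends `ℓ₁ = (1,1,0)` to `(1,−1,0)` whereas the reflection fixes `ℓ₁`) or `Δ³`. -/
theorem conjPt_probe : conjPt (1, 0, -1) = (1, 0, 1) ∧ deltaPt (1, 0, -1) = (1, 1, 0) ∧ conjPt (1, 1, 0) = (1, 1, 0) ∧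
    deltaPt (deltaPt (1, 1, 0)) = (1, -1, 0) := by decide

end Chirality

end Summit.Ventures.HSemireg.Pad4Tower
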